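import Mathlib
import Summits.Ventures.PercRepro2.HCov
import Summits.Ventures.PercRepro2.HCovCubic
import Summits.Ventures.PercRepro2.TriDisagreement
import Summits.Ventures.PercRepro2.TriDisagreementPinned
import Summits.Ventures.PercRepro2.TypedSplit
import Summits.Ventures.PercRepro2.OneTypedEdge
import Summits.Ventures.PercRepro2.StarPattern

/-!
# The chain multi-state coefficient of a degree-three star (blind cell PercRepro2, p1 g11;
ASSIGNMENTS v12.29 addendum (8′): «the Lean target for ENL is the multinomial coefficient
`chainCoeff` = Σ over state assignments (one state per copy, prescribed counts) of the kernel over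
typed placements; 2′TRI-CH := ∀ counts, 0 ≤ chainCoeff»)

A MULTI-STATE ELEMENT at the unmarked vertex `y` is a chain of blocks of its star
`∅ = B 0 ⊂ B 1 ⊂ … ⊂ B r` (blocks = sets of the three star edges `s₁, s₂, s₃`, written as
`Bool × Bool × Bool` patterns as in `StarPattern`); a STATE ASSIGNMENT gives each of the three
copies one state `σ c ∈ {0, …, r}` (copy `c` opens exactly the star edges of `B (σ c)`); the
MULTINOMIAL (chain) COEFFICIENT with prescribed counts `k` (`k i` = the number of copies in
state `i`, `Σ k = 3`) is the sum over those assignments of the pattern count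
`patCount (B (σ 0)) (B (σ 1)) (B (σ 2))`. A typed edge of type `t` is the chain `∅ ⊂ {e}` with
counts `(3 − t, t)` (the split `typedCount_split` / `sum_bool3_*`); the one-block bases `Bone P`
/ `Btype2 P` are the chains `∅ ⊂ P` with counts `(2, 1)` / `(1, 2)`.

Row 2′TRI-CH (CONJECTURES v2.99gc, the lead's): every such coefficient is `≥ 0` — stated here
as `TriCH`, a definition only (no claim proved; its antichain analogue is false).
-/

namespace Summit.Ventures.PercRepro2

open CovForm CovForm.OneTyped CovForm.TypedRed

namespace StarPattern

section Chain

variable {V : Type*} {E : Type*} [Fintype E] [DecidableEq E] {R : Type*} [Field R]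

/-- The componentwise order on star patterns: `P ⊆ Q` as sets of star edges. -/
def patLE (P Q : Bool × Bool × Bool) : Prop :=
  (P.1 = true → Q.1 = true) ∧ (P.2.1 = true → Q.2.1 = true) ∧ (P.2.2 = true → Q.2.2 = true)

/-- `B 0 ⊂ B 1 ⊂ … ⊂ B r` is a chain of blocks starting at `∅`. -/
def IsChain {r : ℕ} (B : Fin (r + 1) → Bool × Bool × Bool) : Prop :=
  B 0 = (false, false, false) ∧
    ∀ i j : Fin (r + 1), i < j → patLE (B i) (B j) ∧ B i ≠ B j

/-- The state assignments `σ : copies → states` with the prescribed counts `k`. -/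
def assignments {r : ℕ} (k : Fin (r + 1) → ℕ) : Finset (Fin 3 → Fin (r + 1)) :=
  Finset.univ.filter fun σ => ∀ i, (Finset.univ.filter fun c => σ c = i).card = k i

/-- **The chain (multinomial) coefficient**: the pattern counts of all state assignments with
the prescribed counts. -/
noncomputable def chainCoeff (ends : E → Sym2 V) (o a₁ a₂ a₃ b : V) (s₁ s₂ s₃ : E) (F₀ : Finset E)
    (z₀ : Config E) (τ : E → ℕ) {r : ℕ} (B : Fin (r + 1) → Bool × Bool × Bool)
    (k : Fin (r + 1) → ℕ) : R :=
  ∑ σ ∈ assignments k,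
    patCount ends o a₁ a₂ a₃ b s₁ s₂ s₃ F₀ z₀ τ (B (σ 0)) (B (σ 1)) (B (σ 2))

/-- The three assignments with counts `(2, 1)`: one copy in state `1`. -/
lemma assignments_two_one :
    assignments (r := 1) ![2, 1] = {![1, 0, 0], ![0, 1, 0], ![0, 0, 1]} := by
  decide

/-- **The type-`1` chain is the one-block base**: the chain `∅ ⊂ P` with counts `(2, 1)` sums the
three placements of the block `P` in one copy. -/
theorem chainCoeff_two_one (ends : E → Sym2 V) (o a₁ a₂ a₃ b : V) (s₁ s₂ s₃ : E) (F₀ : Finset E)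
    (z₀ : Config E) (τ : E → ℕ) (P : Bool × Bool × Bool) :
    chainCoeff (R := R) ends o a₁ a₂ a₃ b s₁ s₂ s₃ F₀ z₀ τ ![(false, false, false), P] ![2, 1] =
      patCount ends o a₁ a₂ a₃ b s₁ s₂ s₃ F₀ z₀ τ P (false, false, false) (false, false, false) +
      patCount ends o a₁ a₂ a₃ b s₁ s₂ s₃ F₀ z₀ τ (false, false, false) P (false, false, false) +
      patCount ends o a₁ a₂ a₃ b s₁ s₂ s₃ F₀ z₀ τ (false, false, false) (false, false, false) P := by
  unfold chainCoeff
  rw [assignments_two_one]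
  rw [Finset.sum_insert (by decide), Finset.sum_insert (by decide), Finset.sum_singleton]
  simp only [Matrix.cons_val_zero, Matrix.cons_val_one, Matrix.head_cons, Matrix.cons_val_two,
    Matrix.tail_cons]
  ring

/-- The three assignments with counts `(1, 2)`: one copy in state `0`. -/
lemma assignments_one_two :
    assignments (r := 1) ![1, 2] = {![0, 1, 1], ![1, 0, 1], ![1, 1, 0]} := by
  decide

/-- **The type-`2` chain is the two-copy base**: the chain `∅ ⊂ P` with counts `(1, 2)` sums the
three placements of the block `P` in two copies. -/
theorem chainCoeff_one_two (ends : E → Sym2 V) (o a₁ a₂ a₃ b : V) (s₁ s₂ s₃ : E) (F₀ : Finset E)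
    (z₀ : Config E) (τ : E → ℕ) (P : Bool × Bool × Bool) :
    chainCoeff (R := R) ends o a₁ a₂ a₃ b s₁ s₂ s₃ F₀ z₀ τ ![(false, false, false), P] ![1, 2] =
      patCount ends o a₁ a₂ a₃ b s₁ s₂ s₃ F₀ z₀ τ (false, false, false) P P +
      patCount ends o a₁ a₂ a₃ b s₁ s₂ s₃ F₀ z₀ τ P (false, false, false) P +
      patCount ends o a₁ a₂ a₃ b s₁ s₂ s₃ F₀ z₀ τ P P (false, false, false) := by
  unfold chainCoeff
  rw [assignments_one_two]
  rw [Finset.sum_insert (by decide), Finset.sum_insert (by decide), Finset.sum_singleton]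
  simp only [Matrix.cons_val_zero, Matrix.cons_val_one, Matrix.head_cons, Matrix.cons_val_two,
    Matrix.tail_cons]
  ring

/-- The six assignments with counts `(1, 1, 1)` on a chain of length `2`: the permutations. -/
lemma assignments_one_one_one :
    assignments (r := 2) ![1, 1, 1] =
      {![0, 1, 2], ![0, 2, 1], ![1, 0, 2], ![1, 2, 0], ![2, 0, 1], ![2, 1, 0]} := by
  decide

/-- **The exclusive nested leaf** of the chain `∅ ⊂ p ⊂ S` with counts `(1, 1, 1)`: the six
orderings of `(∅, p, S)` over the copies. -/
theorem chainCoeff_one_one_one (ends : E → Sym2 V) (o a₁ a₂ a₃ b : V) (s₁ s₂ s₃ : E)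
    (F₀ : Finset E) (z₀ : Config E) (τ : E → ℕ) (p S : Bool × Bool × Bool) :
    chainCoeff (R := R) ends o a₁ a₂ a₃ b s₁ s₂ s₃ F₀ z₀ τ ![(false, false, false), p, S]
        ![1, 1, 1] =
      patCount ends o a₁ a₂ a₃ b s₁ s₂ s₃ F₀ z₀ τ (false, false, false) p S +
      patCount ends o a₁ a₂ a₃ b s₁ s₂ s₃ F₀ z₀ τ (false, false, false) S p +
      patCount ends o a₁ a₂ a₃ b s₁ s₂ s₃ F₀ z₀ τ p (false, false, false) S +
      patCount ends o a₁ a₂ a₃ b s₁ s₂ s₃ F₀ z₀ τ p S (false, false, false) +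
      patCount ends o a₁ a₂ a₃ b s₁ s₂ s₃ F₀ z₀ τ S (false, false, false) p +
      patCount ends o a₁ a₂ a₃ b s₁ s₂ s₃ F₀ z₀ τ S p (false, false, false) := by
  unfold chainCoeff
  rw [assignments_one_one_one]
  rw [Finset.sum_insert (by decide), Finset.sum_insert (by decide), Finset.sum_insert (by decide),
    Finset.sum_insert (by decide), Finset.sum_insert (by decide), Finset.sum_singleton]
  simp only [Matrix.cons_val_zero, Matrix.cons_val_one, Matrix.head_cons, Matrix.cons_val_two,
    Matrix.tail_cons]
  ring

end Chain

section Conjecture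

variable {V : Type*} {E : Type*} [Fintype E] [DecidableEq E] {R : Type*} [Field R] [LinearOrder R]

/-- **Row 2′TRI-CH (chain multi-state 2′TRI)** at a degree-three star: for every chain of blocks
and every count vector summing to `3`, the chain coefficient of the typed instance
`(F₀, z₀, τ)` is nonnegative. A definition only.
SCOPE (NEG-108): conjectured for the one-rung-down objects of GRAPHS — `(F₀, z₀, τ)` the typed
edges of `G − y`, `G` a finite graph (unmarked vertices allowed), the blocks the pieces of THIS star —
and for the five-mark base; NOT for typed hypergraphs with unmarked vertices (`H*`: `N = −2`). -/
def TriCH (ends : E → Sym2 V) (o a₁ a₂ a₃ b : V) (s₁ s₂ s₃ : E) (F₀ : Finset E) (z₀ : Config E)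
    (τ : E → ℕ) : Prop :=
  ∀ (r : ℕ) (B : Fin (r + 1) → Bool × Bool × Bool), IsChain B →
    ∀ k : Fin (r + 1) → ℕ, ∑ i, k i = 3 →
      0 ≤ chainCoeff (R := R) ends o a₁ a₂ a₃ b s₁ s₂ s₃ F₀ z₀ τ B k

end Conjecture

end StarPattern

end Summit.Ventures.PercRepro2
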